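import Mathlib

/-!
# Galois descent of invariant vectors in `K ⊗[F] V` for a finite Galois extension `K/F` — the «only unpaged
sentence» of T3.4 (LEMMA-R-RESIDUE.md §7), on the kernel

Blind re-derivation cell `pub-hodge-repro`, seat `t3-p4` (Tier 3, T3.5 for T3.4).  Target tree path
`lean/Summits/Ventures/HodgeRepro/Tier3GaloisDescent.lean`; Mathlib only.

LEMMA-R-RESIDUE.md §4(c) descends the orbit idempotent `e = Σ_{σ} e_{(σ,…,σ)} ∈ R ⊗_ℚ F` (`R = F^{⊗ 2p}`, `F/ℚ` a
finite Galois CM field) to `R` by the sentence «an element of `R ⊗_ℚ F` fixed by `Gal(F/ℚ)` acting on the second factor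
lies in `R ⊗ 1`».  This file proves that sentence for an arbitrary vector space `V` over a field `F₀` and a finite
Galois extension `K/F₀`: `exists_tmul_of_forall_rTensor_eq` — if `w ∈ K ⊗[F₀] V` satisfies
`(σ ⊗ 1) w = w` for every `σ ∈ Gal(K/F₀)`, then `w = 1 ⊗ v` for some `v ∈ V`.  Proof: in the `K`-basis `1 ⊗ b_i` of
`K ⊗ V` (`b` an `F₀`-basis of `V`), `σ ⊗ 1` acts on the coordinates by `σ`; a vector fixed by every `σ` has
coordinates in the fixed field of the full Galois group, which is `F₀` (Mathlib `IntermediateField.mem_range_algebraMap_iff_fixed`,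
the fundamental theorem of Galois theory `fixedField_top`).  Applied with `F₀ = ℚ`, `K = F`, `V = R`.

HONESTY.  A statement of linear algebra on Mathlib; nothing here is about Hodge classes.  HC_CM is NOT proved by anyone
in this repository.
-/

set_option autoImplicit false

open TensorProduct

namespace HodgeRepro.Tier3

variable {F₀ K : Type*} [Field F₀] [Field K] [Algebra F₀ K] [IsGalois F₀ K] [FiniteDimensional F₀ K]
variable {V : Type*} [AddCommGroup V] [Module F₀ V]

omit [IsGalois F₀ K] [FiniteDimensional F₀ K] in
/-- The coordinates of `(σ ⊗ 1) w` in the basis `1 ⊗ b_i` are `σ` of the coordinates of `w`. -/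
theorem basis_repr_rTensor {ι : Type*} (b : Module.Basis ι F₀ V) (σ : K ≃ₐ[F₀] K) (w : K ⊗[F₀] V) (i : ι) :
    (Algebra.TensorProduct.basis K b).repr (LinearMap.rTensor V σ.toLinearMap w) i =
      σ ((Algebra.TensorProduct.basis K b).repr w i) := by
  induction w using TensorProduct.induction_on with
  | zero => simp
  | tmul a m =>
    simp [Algebra.TensorProduct.basis_repr_tmul, Finsupp.mapRange_apply, map_mul]
  | add x y hx hy =>
    simp only [map_add, Finsupp.add_apply, hx, hy]

/-- **Galois descent of invariant vectors**: an element of `K ⊗[F₀] V` fixed by `σ ⊗ 1` for every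
`σ ∈ Gal(K/F₀)` lies in `1 ⊗ V`. -/
theorem exists_tmul_of_forall_rTensor_eq (w : K ⊗[F₀] V)
    (hw : ∀ σ : K ≃ₐ[F₀] K, LinearMap.rTensor V σ.toLinearMap w = w) : ∃ v : V, w = (1 : K) ⊗ₜ v := by
  classical
  let b := Module.Basis.ofVectorSpace F₀ V
  let B := Algebra.TensorProduct.basis K b
  -- every coordinate is Galois-fixed, hence in `F₀`
  have hfix : ∀ i, ∀ σ : K ≃ₐ[F₀] K, σ (B.repr w i) = B.repr w i := fun i σ => by
    rw [← basis_repr_rTensor b σ w i, hw σ]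
  have hrange : ∀ i, B.repr w i ∈ Set.range (algebraMap F₀ K) := fun i =>
    (IsGalois.mem_range_algebraMap_iff_fixed (B.repr w i)).mpr (hfix i)
  choose d hd using hrange
  -- assemble `v := Σ d_i • b_i` over the support of the coordinates
  refine ⟨(B.repr w).sum fun i _ => d i • b i, ?_⟩
  conv_lhs => rw [← B.linearCombination_repr w]
  rw [Finsupp.linearCombination_apply]
  simp only [Finsupp.sum]
  rw [TensorProduct.tmul_sum]
  refine Finset.sum_congr rfl fun i _ => ?_
  rw [Algebra.TensorProduct.basis_repr_symm_apply', ← hd i, Algebra.algebraMap_eq_smul_one,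
    TensorProduct.smul_tmul]

end HodgeRepro.Tier3
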